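import Literature.NumberTheory.Automorphic.TestFunctionDerivLinear
import Literature.NumberTheory.Automorphic.SmoothedVectorTranslation
import Literature.NumberTheory.Automorphic.GLnAdelicIntegrationFactsProofs
import Literature.NumberTheory.Automorphic.GLnMaximalCompactCompact
import Literature.NumberTheory.Automorphic.AutomorphicRepsGLCuspidalL2Step1KFinite
import HarnessLib

/-!
# Smoothed vectors of the translates of an `Ad(K_∞)`-invariant weight by the maximal compact subgroup

Topic `NumberTheory/Automorphic`; namespace `Literature.NumberTheory.Automorphic`. Theorems only (one
definition with body, `rightTranslateWeight`). The `K`-uniformity input of the plumbing of the Kirillov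
`L²`-bound into the Rankin–Selberg torus integral (the `n ≤ 2` case of the named fact
`JacquetShalika1981_partialPairL_pole_of_eq_conj`): there the torus integrand is evaluated at
`diag(a) k`, `k ∈ K = K_∞ GL_n(𝒪̂)`, which replaces the weight `η` of the smoothed form by its left
translate `L_k η` and the archimedean derivatives `η_u` by `(L_k η)_u`; one needs the bound
`‖S_{(L_k η)_u} f‖ ≤ ‖η_u‖_{L¹} ‖f‖` UNIFORMLY in `k ∈ K`. For a weight invariant under
conjugation by `K_∞` (such weights with any prescribed level and support exist,
`AutomorphicRepsGL.exists_adInvariant_symmetric_testWeight`) this is formal: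

* `rightTranslateWeight h η = η(· h)`; `wordDerivWeight_rightTranslateWeight` — left-invariant
  archimedean derivatives commute with right translations;
* `smoothedVector_rightTranslateWeight` — `S_{η(· h)} f = S_η (R(h⁻¹) f)` (right invariance of the
  Haar measure of the unimodular `GL_n(𝔸_K)`);
* `leftTranslateWeight_eq_rightTranslateWeight_of_adInvariant` — `L_κ η = η(· κ⁻¹)` for `η`
  invariant under conjugation by `κ`;
* `norm_smoothedVector_wordDerivWeight_leftTranslate_le` (**main**) — for a test function `η`
  invariant under conjugation by `K_∞`, every `k ∈ K`, every word `u` and every `f ∈ W`: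
  `‖S_{(L_k η)_u} f‖ ≤ (∫ |η_u|) ‖f‖`.

(Bump (1997), Prop. 2.3.1 is the commutation `R(k) R(η) = R(η) R(k)` for such `η`,
`toContRep_smoothedVector_comm`.)

## References

* D. Bump, *Automorphic forms and representations* (1997), Prop. 2.3.1 (PDF p. 166), (2.28)–(2.29)
  [Bump1997].
-/

noncomputable section

open scoped MatrixGroups Classical ContDiff
open NumberField NumberField.mixedEmbedding IsDedekindDomain MeasureTheory

namespace Literature.NumberTheory.Automorphic

variable {n : ℕ} {K : Type} [Field K] [NumberField K]
  (hcpt : isCompact_glFiniteIntegralLevel n K)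

set_option backward.isDefEq.respectTransparency false
set_option synthInstance.maxHeartbeats 400000

attribute [local instance 100] LieRing.ofAssociativeRing

/-! ### Right translates of weights -/

section Right

/-- The right translate `η(· h)` of a weight. [folklore] -/
def rightTranslateWeight (h : (AdelicGroupData.gl n K).Adelic) (η : (AdelicGroupData.gl n K).Adelic → ℝ) :
    (AdelicGroupData.gl n K).Adelic → ℝ :=
  fun g => η (g * h)

/-- Unfolding. [folklore] -/
theorem rightTranslateWeight_apply (h : (AdelicGroupData.gl n K).Adelic) (η : (AdelicGroupData.gl n K).Adelic → ℝ) (g : (AdelicGroupData.gl n K).Adelic) :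
    rightTranslateWeight h η g = η (g * h) := rfl

/-- **Left-invariant derivatives commute with right translations.** [cite: Bump1997, (2.28)–(2.29) (PDF p. 279)] -/
theorem derivWeight_rightTranslateWeight (X : (AutomorphyDatum.gl n K hcpt).arch.lie) (h : (AdelicGroupData.gl n K).Adelic)
    (η : (AdelicGroupData.gl n K).Adelic → ℝ) :
    derivWeight (AutomorphyDatum.gl n K hcpt).ofArch X (rightTranslateWeight h η) =
      rightTranslateWeight h (derivWeight (AutomorphyDatum.gl n K hcpt).ofArch X η) := by
  funext g
  simp only [derivWeight, rightTranslateWeight, mul_assoc]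

/-- The same for words. [folklore] -/
theorem wordDerivWeight_rightTranslateWeight (h : (AdelicGroupData.gl n K).Adelic) (η : (AdelicGroupData.gl n K).Adelic → ℝ) :
    ∀ w : List (AutomorphyDatum.gl n K hcpt).arch.lie,
      wordDerivWeight (AutomorphyDatum.gl n K hcpt).ofArch w (rightTranslateWeight h η) =
        rightTranslateWeight h (wordDerivWeight (AutomorphyDatum.gl n K hcpt).ofArch w η)
  | [] => rfl
  | X :: w => by
    rw [wordDerivWeight_cons, wordDerivWeight_cons, wordDerivWeight_rightTranslateWeight h η w, derivWeight_rightTranslateWeight]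

/-- **`L_κ η = η(· κ⁻¹)`** for a weight invariant under conjugation by `κ`. [folklore] -/
theorem leftTranslateWeight_eq_rightTranslateWeight_of_adInvariant {η : (AdelicGroupData.gl n K).Adelic → ℝ}
    {κ : (AdelicGroupData.gl n K).Adelic} (hκ : ∀ g, η (κ * g * κ⁻¹) = η g) :
    leftTranslateWeight (n := n) κ η = rightTranslateWeight κ⁻¹ η := by
  funext g
  rw [rightTranslateWeight_apply]
  show η (κ⁻¹ * g) = η (g * κ⁻¹)
  have h := hκ (κ⁻¹ * g)
  rw [show κ * (κ⁻¹ * g) * κ⁻¹ = g * κ⁻¹ by group] at h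
  exact h.symm

/-- Continuity of right translates. [folklore] -/
theorem continuous_rightTranslateWeight {η : (AdelicGroupData.gl n K).Adelic → ℝ} (hη : Continuous η) (h : (AdelicGroupData.gl n K).Adelic) :
    Continuous (rightTranslateWeight h η) :=
  hη.comp (continuous_id.mul continuous_const)

/-- Compact support of right translates. [folklore] -/
theorem hasCompactSupport_rightTranslateWeight {η : (AdelicGroupData.gl n K).Adelic → ℝ} (hηs : HasCompactSupport η) (h : (AdelicGroupData.gl n K).Adelic) :
    HasCompactSupport (rightTranslateWeight h η) := by
  have he : rightTranslateWeight h η = η ∘ Homeomorph.mulRight h := rfl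
  rw [he]
  exact hηs.comp_homeomorph _

end Right

/-! ### Smoothing by right translates -/

section Smoothing

variable {μ : Measure (AdelicGroupData.gl n K).automorphicQuotient} [(AdelicGroupData.gl n K).IsAutomorphicMeasure μ]
variable (W : ContRepresentation.ClosedSubrep ((AdelicGroupData.gl n K).rightRegular μ))

attribute [local instance] adelicBorel borelSpace_adelic locallyCompactSpace_adelic secondCountableTopology_gl_adelic

/-- **`S_{η(· h)} f = S_η (R(h⁻¹) f)`** (right invariance of the Haar measure). [folklore] -/
theorem smoothedVector_rightTranslateWeight (η : (AdelicGroupData.gl n K).Adelic → ℝ)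
    (h : (AdelicGroupData.gl n K).Adelic) (f : W.toSubmodule) :
    smoothedVector W (rightTranslateWeight h η) f = smoothedVector W η (W.toContRep h⁻¹ f) := by
  haveI : (adelicHaar n K).IsMulRightInvariant :=
    isMulRightInvariant_adelicHaar n K (GLn.isMulRightInvariant_of_isHaarMeasure_adelic_holds n K)
  unfold smoothedVector
  have key : ∫ g, ((rightTranslateWeight h η g : ℝ) : ℂ) • W.toContRep g f ∂adelicHaar n K =
      ∫ g, ((η g : ℝ) : ℂ) • W.toContRep (g * h⁻¹) f ∂adelicHaar n K := by
    have hfun : (fun g => ((rightTranslateWeight h η g : ℝ) : ℂ) • W.toContRep g f) =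
        fun g => (fun x => ((η x : ℝ) : ℂ) • W.toContRep (x * h⁻¹) f) (g * h) := by
      funext g
      simp only [rightTranslateWeight_apply, mul_assoc, mul_inv_cancel, mul_one]
    rw [hfun]
    exact integral_mul_right_eq_self (fun x => ((η x : ℝ) : ℂ) • W.toContRep (x * h⁻¹) f) h
  rw [key]
  congr 1
  funext g
  rw [map_mul]
  rfl

/-- **`‖S_{η(· h)} f‖ ≤ ‖η‖_{L¹} ‖f‖.** [folklore] -/
theorem norm_smoothedVector_rightTranslateWeight_le {η : (AdelicGroupData.gl n K).Adelic → ℝ} (hη : Continuous η) (hηs : HasCompactSupport η)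
    (h : (AdelicGroupData.gl n K).Adelic) (f : W.toSubmodule) :
    ‖smoothedVector W (rightTranslateWeight h η) f‖ ≤ (∫ g, ‖(η g : ℂ)‖ ∂(adelicHaar n K)) * ‖f‖ := by
  rw [smoothedVector_rightTranslateWeight W η h f]
  refine (norm_smoothedVector_le W hη hηs _).trans (le_of_eq ?_)
  congr 1
  exact (AdelicGroupData.gl n K).norm_rightRegular_apply μ h⁻¹ (f : (AdelicGroupData.gl n K).L2 μ)

end Smoothing

/-! ### The bound under the maximal compact subgroup -/

section MaxCompact

variable {μ : Measure (AdelicGroupData.gl n K).automorphicQuotient} [(AdelicGroupData.gl n K).IsAutomorphicMeasure μ]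
variable (W : ContRepresentation.ClosedSubrep ((AdelicGroupData.gl n K).rightRegular μ))

attribute [local instance] adelicBorel borelSpace_adelic locallyCompactSpace_adelic secondCountableTopology_gl_adelic

/-- The `L¹`-norm of a left translate. [folklore] -/
theorem integral_norm_leftTranslateWeight (η : (AdelicGroupData.gl n K).Adelic → ℝ) (b : (AdelicGroupData.gl n K).Adelic) :
    ∫ g, ‖((leftTranslateWeight (n := n) b η g : ℝ) : ℂ)‖ ∂(adelicHaar n K) = ∫ g, ‖(η g : ℂ)‖ ∂(adelicHaar n K) :=
  integral_mul_left_eq_self (fun g => ‖((η g : ℝ) : ℂ)‖) b⁻¹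

/-- **`‖S_{(L_k η)_u} f‖ ≤ ‖η_u‖_{L¹} ‖f‖` uniformly in `k ∈ K = K_∞ GL_n(𝒪̂)`** for a test function `η`
invariant under conjugation by `K_∞`. [cite: Bump1997, Prop. 2.3.1 (PDF p. 166)] -/
theorem norm_smoothedVector_wordDerivWeight_leftTranslate_le {η : (AdelicGroupData.gl n K).Adelic → ℝ} (hη : IsTestFunctionGL n K η)
    (had : ∀ (κ : (AutomorphyDatum.gl n K hcpt).arch.maximalCompact) (g : (AdelicGroupData.gl n K).Adelic),
      η ((AutomorphyDatum.gl n K hcpt).ofK κ * g * ((AutomorphyDatum.gl n K hcpt).ofK κ)⁻¹) = η g)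
    {k : (AdelicGroupData.gl n K).Adelic} (hk : k ∈ maximalCompactAdelic n K) (u : List (AutomorphyDatum.gl n K hcpt).arch.lie)
    (f : W.toSubmodule) :
    ‖smoothedVector W (wordDerivWeight (AutomorphyDatum.gl n K hcpt).ofArch u (leftTranslateWeight (n := n) k η)) f‖ ≤
      (∫ g, ‖((wordDerivWeight (AutomorphyDatum.gl n K hcpt).ofArch u η g : ℝ) : ℂ)‖ ∂(adelicHaar n K)) * ‖f‖ := by
  -- `k = a b`, `a = (κ, 1)`, `b ∈ GL_n(𝒪̂)`
  have hk' : k ∈ (standardMaximalCompactGL n K : Set (GL (Fin n) (AdeleRing (𝓞 K) K))) := hk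
  rw [coe_standardMaximalCompactGL_eq_mul] at hk'
  obtain ⟨a, ha, b, hb, rfl⟩ := Set.mem_mul.1 hk'
  obtain ⟨κ, hκ, hκa⟩ := Subgroup.mem_map.1 ha
  -- `L_{ab} η = L_a (L_b η)` and `L_b` commutes with the archimedean derivatives
  have hb1 : GLn.toMixed n K b = 1 := by rw [GLn.toMixed_apply, (mem_glIntegralLevel_iff.1 hb).2, map_one]
  set θ : (AdelicGroupData.gl n K).Adelic → ℝ := leftTranslateWeight (n := n) b η with hθ
  have hθt : IsTestFunctionGL n K θ := hη.leftTranslate b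
  have hLab : leftTranslateWeight (n := n) (a * b) η = leftTranslateWeight (n := n) a θ := by
    funext g; simp only [leftTranslateWeight, hθ, mul_inv_rev, mul_assoc]
  -- `θ` is still invariant under conjugation by `a = (κ, 1)`
  have hcomm : Commute a b := by
    have hbeq : b = GLn.ofFinite n K (GLn.sndHom n K b) := GLn.eq_ofFinite_sndHom_of_fstHom_eq_one (mem_glIntegralLevel_iff.1 hb).2
    rw [hbeq, ← hκa]; exact GLn.commute_ofInfinite_ofFinite κ _
  have hθad : ∀ g, θ (a * g * a⁻¹) = θ g := by
    intro g
    have h1 : η (a * (b⁻¹ * g) * a⁻¹) = η (b⁻¹ * g) := by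
      have h := had ⟨κ, hκ⟩ (b⁻¹ * g)
      have hofK : (AutomorphyDatum.gl n K hcpt).ofK ⟨κ, hκ⟩ = a := hκa
      rwa [hofK] at h
    simp only [hθ, leftTranslateWeight]
    have e : b⁻¹ * (a * g * a⁻¹) = a * (b⁻¹ * g) * a⁻¹ := by
      simp only [← mul_assoc]
      rw [hcomm.inv_right.eq]
    rw [e]
    exact h1
  -- `L_a θ = θ(· a⁻¹)`, derivatives commute with right translation
  rw [hLab, leftTranslateWeight_eq_rightTranslateWeight_of_adInvariant hθad, wordDerivWeight_rightTranslateWeight hcpt]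
  have hθu : IsTestFunctionGL n K (wordDerivWeight (AutomorphyDatum.gl n K hcpt).ofArch u θ) := isTestFunctionGL_wordDerivWeight' hcpt hθt u
  refine (norm_smoothedVector_rightTranslateWeight_le W hθu.continuous hθu.hasCompactSupport _ f).trans (le_of_eq ?_)
  congr 1
  rw [hθ, wordDerivWeight_leftTranslateWeight_of_toMixed_eq_one hcpt hη hb1 u, integral_norm_leftTranslateWeight]

end MaxCompact

end Literature.NumberTheory.Automorphic
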